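import Literature.Topology.FourManifolds.TautFoliationsFoliatedMaps
import Literature.Topology.FourManifolds.TautFoliationsFences
import HarnessLib

/-!
# Push-forward of fences along foliated maps

For a foliated map `f : (X, F') → (M, F)` (`TautFoliationsFoliatedMaps.lean`: near every
point a transverse coordinate of `F'` is a homeomorphism germ of a transverse coordinate of
`F` composed with `f`) and a fence `Φ'` of `F'` over a compact Hausdorff parameter space `A`
for a continuous family of germs `Γ'` (`TautFoliationsFences.lean`), the composite
`(a, τ) ↦ f (Φ' a τ)` is a fence of `F` for the pushed family `pushGerm ∘ Γ'`, on a smaller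
level interval (`IsFoliatedMap.exists_isFenceOn_comp`). Its horizontals are the images of
the horizontals of `Φ'` — leaf maps of `F` — and its verticals the images of the verticals,
transversals of `F` on which the levels of `Γ'` serve as transverse parameter. This is how a
one-parameter family of closed orbits of the foliation induced on a disc in general position
is compared with the leaves of the ambient foliation (Camacho–Lins Neto, *Geometric Theory of
Foliations*, Ch. VII §2, proof of Prop. 1: "`g(γ_t)` and `δ_t` are homotopic in `A_t`" —
with fences they can be made *equal*, by extending the pushed fence relatively over the disc).

* `LocalDatum.isHomeoGermAt_φ` (**proved**): the first-integral function of a local datum is a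
  homeomorphism germ at the base height.
* `IsFoliatedMap.exists_localDatum_comp` (**proved**): the local step — near a parameter `a`,
  the pushed data `(ê, φ' ∘ φ̂, κ ∘ ψ')` (where `(e', φ', ψ')` is the local datum of `Φ'` at
  `a`, `h_{e'} = φ̂ ∘ h_ê ∘ f` near the base point and `κ` is the inverse germ of `φ̂`) form a
  local datum of `F` for `pushGerm ∘ Γ'` in which `f ∘ Φ'` levels correctly, for a smaller
  level radius.
* `IsFoliatedMap.exists_isFenceOn_comp` (**proved**): the global statement over a compact
  parameter space (finite subcover, minimum of the radii).
* `IsFenceOn.comp_right`, `IsFenceOn.congr_germ` (**proved**): pulling a fence back along a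
  continuous map of parameter spaces; changing the family of germs on the base set.
* `apply_eq_of_proj_eq_const`, `apply_eq_of_proj_eq` (**proved**): continuous families of germs
  over preconnected sets — constant when lying over one point, determined by one value when
  lifting the same leaf map (discreteness of the fibres, uniqueness of lifts).
* `homotopic_refl_of_forall_mem_plaque` (**proved**): a leaf loop running in one plaque is
  null-homotopic in the leaf topology (linear interpolation in the leaf model).

## References

* C. Camacho, A. Lins Neto, *Geometric Theory of Foliations*, Birkhäuser (1985), Ch. IV §2
  (Lemma 4), Ch. VII §2 Prop. 1 [CamachoLinsNeto1985].
* G. Hector, U. Hirsch, *Introduction to the Geometry of Foliations, Part A*, 2nd ed., Vieweg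
  (1986), Ch. III 2.1 [HectorHirsch1986].
-/

open Set Filter Function Topology unitInterval

namespace Literature.Topology.FourManifolds

namespace Foliation

variable {B : Type*} [NormedAddCommGroup B] {M : Type*} [TopologicalSpace M]
variable {B' : Type*} [NormedAddCommGroup B'] {X : Type*} [TopologicalSpace X]
variable {F' : Foliation B' X} {F : Foliation B M}
variable {A : Type*}

/-! ## The first integral of a local datum is a homeomorphism germ -/

/-- **The first-integral function `φ` of a local datum is a homeomorphism germ** at the base
height `ψ τ₀` (its composite with `h_e` is a distinguished germ). [folklore] -/
theorem LocalDatum.isHomeoGermAt_φ {G : A → F.GermSpace} {τ₀ ε : ℝ} {U : Set A}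
    (D : LocalDatum F G τ₀ ε U) {a : A} (ha : a ∈ U) : IsHomeoGermAt D.φ (D.ψ τ₀) := by
  obtain ⟨χ, hχ, hχe⟩ := (G a).isDist.exists_eq D.box_mem (D.pt_mem_source ha)
  rw [D.germ_eq a ha] at hχe
  have h := F.eventuallyEq_of_comp_height_eq D.box_mem (D.pt_mem_source ha) hχe
  have hh : (D.box (ofLeafSpace (G a).pt)).2 = D.ψ τ₀ := D.height_pt ha
  rw [hh] at h hχ
  exact hχ.congr h.symm

namespace IsFoliatedMap

variable [TopologicalSpace A] {f : X → M}

/-! ## The local step -/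

/-- **The pushed local datum.** Let `f` be a foliated map, `Φ'` a fence of `F'` over the open
set `S` for the continuous family `Γ'`, and `a ∈ S`. Then near `a` there is a local datum of
`F` for the pushed family `pushGerm ∘ Γ'` in which the composite `f ∘ Φ'` levels correctly,
for some smaller level radius: if `(e', φ', ψ')` is the local datum of `Φ'` at `a` and
`h_{e'} = φ̂ ∘ h_ê ∘ f` near the base point `Φ' a τ₀` (`exists_compat`), with `κ` the
inverse germ of `φ̂`, the datum is `(ê, φ' ∘ φ̂, κ ∘ ψ')`. [folklore] -/
theorem exists_localDatum_comp (hf : IsFoliatedMap F' F f) (Γ' : C(A, F'.GermSpace)) {τ₀ ε : ℝ}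
    (hε : 0 < ε) {Φ' : A → ℝ → X} {S : Set A} (hΦ' : IsFenceOn F' Γ' τ₀ ε Φ' S) (hS : IsOpen S)
    {a : A} (ha : a ∈ S) :
    ∃ W ∈ 𝓝 a, W ⊆ S ∧ ∃ δ > (0 : ℝ), δ ≤ ε ∧ ∃ D : LocalDatum F (hf.pushGerm ∘ Γ') τ₀ δ W,
      ∀ a' ∈ W, ∀ τ ∈ Ioo (τ₀ - δ) (τ₀ + δ),
        f (Φ' a' τ) ∈ D.box.source ∧ height D.box (f (Φ' a' τ)) = D.ψ τ := by
  have hτ₀ : τ₀ ∈ Ioo (τ₀ - ε) (τ₀ + ε) := ⟨by linarith, by linarith⟩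
  -- the local datum `(e', φ', ψ')` of `Φ'` at `a`
  obtain ⟨U, hU, D', hD'⟩ := hΦ'.local_level a ha
  have haU : a ∈ U ∩ S := ⟨mem_of_mem_nhds hU, ha⟩
  have hz : Φ' a τ₀ = ofLeafSpace (Γ' a).pt := hΦ'.base a ha
  have hze' : ofLeafSpace (Γ' a).pt ∈ D'.box.source := D'.pt_mem_source haU
  have hzt : (D'.box (ofLeafSpace (Γ' a).pt)).2 = D'.ψ τ₀ := D'.height_pt haU
  -- a compatible box `ê` of `F` at the image of the base point, `h_{e'} = φ̂ ∘ h_ê ∘ f` on `N`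
  obtain ⟨ê, hê, hzê⟩ := F.exists_mem_source (f (ofLeafSpace (Γ' a).pt))
  obtain ⟨φh, hφh, hcomp⟩ := hf.exists_compat D'.box_mem hze' hê hzê
  obtain ⟨N, hN, hNo, hzN⟩ := eventually_nhds_iff.1 hcomp
  have hφht : φh (ê (f (ofLeafSpace (Γ' a).pt))).2 = D'.ψ τ₀ := by
    rw [apply_height_eq hcomp, hzt]
  -- the inverse germ `κ` of `φ̂`, a homeomorphism germ at `ψ' τ₀`
  obtain ⟨κ, hκ, hκt, hκφ, hφκ⟩ := hφh.exists_inverse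
  rw [hφht] at hκ hκt hφκ
  obtain ⟨ρ₁, hρ₁, hκc, hκm⟩ := hκ
  have hκinj : InjOn κ (Ioo (D'.ψ τ₀ - ρ₁) (D'.ψ τ₀ + ρ₁)) :=
    hκm.elim StrictMonoOn.injOn StrictAntiOn.injOn
  obtain ⟨ρ₂, hρ₂, hρ₂sub⟩ := IsHomeoGermAt.exists_Ioo_subset_of_mem_nhds hφκ
  set ρ : ℝ := min ρ₁ ρ₂ with hρdef
  have hρ : 0 < ρ := lt_min hρ₁ hρ₂
  have hIρ₁ : Ioo (D'.ψ τ₀ - ρ) (D'.ψ τ₀ + ρ) ⊆ Ioo (D'.ψ τ₀ - ρ₁) (D'.ψ τ₀ + ρ₁) :=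
    Ioo_subset_Ioo (by linarith [min_le_left ρ₁ ρ₂]) (by linarith [min_le_left ρ₁ ρ₂])
  have hIρ₂ : Ioo (D'.ψ τ₀ - ρ) (D'.ψ τ₀ + ρ) ⊆ Ioo (D'.ψ τ₀ - ρ₂) (D'.ψ τ₀ + ρ₂) :=
    Ioo_subset_Ioo (by linarith [min_le_right ρ₁ ρ₂]) (by linarith [min_le_right ρ₁ ρ₂])
  have hφκ' : ∀ s ∈ Ioo (D'.ψ τ₀ - ρ) (D'.ψ τ₀ + ρ), φh (κ s) = s := fun s hs ↦ hρ₂sub (hIρ₂ hs)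
  -- the open set `O₁ ∋ t̂` on which `κ ∘ φ̂ = id`
  obtain ⟨O₁, hO₁sub, hO₁o, htO₁⟩ := eventually_nhds_iff.1 hκφ
  -- the good set `𝒩 ∋ Φ' a τ₀` of points of `X`
  set 𝒩 : Set X := N ∩ f ⁻¹' (ê.source ∩ ê ⁻¹' (Prod.snd ⁻¹' O₁)) with h𝒩def
  have h𝒩o : IsOpen 𝒩 :=
    hNo.inter ((ê.isOpen_inter_preimage (hO₁o.preimage continuous_snd)).preimage hf.continuous)
  have hz𝒩 : ofLeafSpace (Γ' a).pt ∈ 𝒩 := ⟨hzN, hzê, htO₁⟩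
  have h𝒩N : ∀ y ∈ 𝒩, height D'.box y = φh (height ê (f y)) := fun y hy ↦ hN y hy.1
  have h𝒩src : ∀ y ∈ 𝒩, f y ∈ ê.source := fun y hy ↦ hy.2.1
  have h𝒩κ : ∀ y ∈ 𝒩, κ (height D'.box y) = height ê (f y) := fun y hy ↦ by
    rw [h𝒩N y hy]
    exact hO₁sub _ hy.2.2
  -- the parameter neighbourhood `W` and the level radius `δ`
  have hT : (uncurry Φ') ⁻¹' 𝒩 ∈ 𝓝 (a, τ₀) := by
    refine (hΦ'.continuousAt hS ha hτ₀).preimage_mem_nhds (h𝒩o.mem_nhds ?_)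
    show Φ' a τ₀ ∈ 𝒩
    rw [hz]
    exact hz𝒩
  obtain ⟨u, hu, v, hv, huv⟩ := mem_nhds_prod_iff.1 hT
  obtain ⟨δ₂, hδ₂, hδ₂v⟩ := IsHomeoGermAt.exists_Ioo_subset_of_mem_nhds hv
  have hψat : ContinuousAt D'.ψ τ₀ := D'.ψ_cont.continuousAt (Ioo_mem_nhds hτ₀.1 hτ₀.2)
  have hIooρ : Ioo (D'.ψ τ₀ - ρ) (D'.ψ τ₀ + ρ) ∈ 𝓝 (D'.ψ τ₀) := Ioo_mem_nhds (by linarith) (by linarith)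
  obtain ⟨δ₁, hδ₁, hδ₁sub⟩ := IsHomeoGermAt.exists_Ioo_subset_of_mem_nhds (hψat.preimage_mem_nhds hIooρ)
  set W : Set A := u ∩ (U ∩ S) with hWdef
  have hW : W ∈ 𝓝 a := inter_mem hu (inter_mem hU (hS.mem_nhds ha))
  set δ : ℝ := min (min δ₁ δ₂) ε with hδdef
  have hδ : 0 < δ := lt_min (lt_min hδ₁ hδ₂) hε
  have hδε : δ ≤ ε := min_le_right _ _
  have hIε : Ioo (τ₀ - δ) (τ₀ + δ) ⊆ Ioo (τ₀ - ε) (τ₀ + ε) := Ioo_subset_Ioo (by linarith) (by linarith)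
  have hIδ₁ : Ioo (τ₀ - δ) (τ₀ + δ) ⊆ Ioo (τ₀ - δ₁) (τ₀ + δ₁) :=
    Ioo_subset_Ioo (by linarith [(min_le_left (min δ₁ δ₂) ε).trans (min_le_left δ₁ δ₂)])
      (by linarith [(min_le_left (min δ₁ δ₂) ε).trans (min_le_left δ₁ δ₂)])
  have hIδ₂ : Ioo (τ₀ - δ) (τ₀ + δ) ⊆ Ioo (τ₀ - δ₂) (τ₀ + δ₂) :=
    Ioo_subset_Ioo (by linarith [(min_le_left (min δ₁ δ₂) ε).trans (min_le_right δ₁ δ₂)])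
      (by linarith [(min_le_left (min δ₁ δ₂) ε).trans (min_le_right δ₁ δ₂)])
  -- levels in the level interval have `ψ' τ` where `κ` is good
  have hψρ : ∀ τ ∈ Ioo (τ₀ - δ) (τ₀ + δ), D'.ψ τ ∈ Ioo (D'.ψ τ₀ - ρ) (D'.ψ τ₀ + ρ) :=
    fun τ hτ ↦ hδ₁sub (hIδ₁ hτ)
  -- points of the fence over `W` with levels in the interval are good
  have hgood : ∀ a' ∈ W, ∀ τ ∈ Ioo (τ₀ - δ) (τ₀ + δ), Φ' a' τ ∈ 𝒩 := fun a' ha' τ hτ ↦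
    huv (mk_mem_prod ha'.1 (hδ₂v (hIδ₂ hτ)))
  have hτ₀δ : τ₀ ∈ Ioo (τ₀ - δ) (τ₀ + δ) := ⟨by linarith, by linarith⟩
  -- base points over `W`: in `𝒩`, with `ê`-height `t̂ = κ (ψ' τ₀)` after `f`
  have hpt : ∀ a' ∈ W, ofLeafSpace (Γ' a').pt ∈ 𝒩 ∧ ofLeafSpace (Γ' a').pt ∈ D'.box.source ∧
      height ê (f (ofLeafSpace (Γ' a').pt)) = κ (D'.ψ τ₀) := by
    intro a' ha'
    have h₁ : ofLeafSpace (Γ' a').pt ∈ 𝒩 := by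
      rw [← hΦ'.base a' ha'.2.2]
      exact hgood a' ha' τ₀ hτ₀δ
    refine ⟨h₁, D'.pt_mem_source ha'.2, ?_⟩
    rw [← h𝒩κ _ h₁, D'.height_pt ha'.2]
  -- the pushed datum
  have hφ'h : IsHomeoGermAt D'.φ (D'.ψ τ₀) := D'.isHomeoGermAt_φ haU
  refine ⟨W, hW, fun a' ha' ↦ ha'.2.2, δ, hδ, hδε,
    ⟨ê, hê, D'.φ ∘ φh, κ ∘ D'.ψ, fun a' ha' ↦ ?_, fun a' ha' ↦ ?_, fun τ hτ ↦ ?_, ?_, ?_, ?_⟩,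
    fun a' ha' τ hτ ↦ ⟨h𝒩src _ (hgood a' ha' τ hτ), ?_⟩⟩
  · -- germ_eq
    obtain ⟨h₁, h₂, h₃⟩ := hpt a' ha'
    refine hf.pushGerm_germ_eq_coe (Γ' a') ?_ ?_
    · refine F.isDistinguishedGerm_comp_height hê (h𝒩src _ h₁) (IsHomeoGermAt.comp ?_ ?_)
      · rw [height_apply] at h₃
        rw [h₃, hκt, hφht]
        exact hφ'h
      · rw [height_apply] at h₃
        rw [h₃, hκt]
        exact hφh
    · rw [D'.germ_eq a' ha'.2, Germ.coe_eq]
      filter_upwards [h𝒩o.mem_nhds h₁] with y hy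
      simp only [comp_apply]
      rw [h𝒩N y hy]
  · -- pt_mem
    obtain ⟨h₁, -, h₃⟩ := hpt a' ha'
    exact ⟨h𝒩src _ h₁, h₃⟩
  · -- φ_ψ
    show D'.φ (φh (κ (D'.ψ τ))) = τ
    rw [hφκ' _ (hψρ τ hτ)]
    exact D'.φ_ψ τ (hIε hτ)
  · -- ψ_φ
    show ∀ᶠ r in 𝓝 (κ (D'.ψ τ₀)), κ (D'.ψ (D'.φ (φh r))) = r
    rw [hκt]
    have hT : Tendsto φh (𝓝 (ê (f (ofLeafSpace (Γ' a).pt))).2) (𝓝 (D'.ψ τ₀)) := by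
      have h := hφh.continuousAt
      rwa [ContinuousAt, hφht] at h
    filter_upwards [hT.eventually D'.ψ_φ, hκφ] with r hr hr'
    simp only [comp_apply, id_eq] at hr'
    rw [hr, hr']
  · -- ψ_cont
    exact hκc.comp (D'.ψ_cont.mono hIε) fun τ hτ ↦ hIρ₁ (hψρ τ hτ)
  · -- ψ_inj
    exact hκinj.comp (D'.ψ_inj.mono hIε) fun τ hτ ↦ hIρ₁ (hψρ τ hτ)
  · -- the fence levels correctly
    show height ê (f (Φ' a' τ)) = κ (D'.ψ τ)
    rw [← h𝒩κ _ (hgood a' ha' τ hτ), (hD' a' ha'.2 τ (hIε hτ)).2]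

/-! ## The global statement -/

/-- **The image of a fence under a foliated map is a fence**, on a smaller level interval:
for a fence `Φ'` of `F'` over the whole compact parameter space `A` for the continuous family
of germs `Γ'`, there is `δ ∈ (0, ε]` such that `(a, τ) ↦ f (Φ' a τ)` is a fence of `F` for
the pushed family `pushGerm ∘ Γ'` of level radius `δ` over all of `A` (the local step at
every point, a finite subcover, the minimum of the radii). Its horizontals are the images of
the horizontals (leaf maps of `F`), its verticals the images of the verticals (Camacho–Lins
Neto, Ch. VII §2, proof of Prop. 1; Ch. IV §2 Lemma 4). [cite: CamachoLinsNeto1985, Ch. VII §2 Prop. 1] -/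
theorem exists_isFenceOn_comp [CompactSpace A] (hf : IsFoliatedMap F' F f) (Γ' : C(A, F'.GermSpace))
    {τ₀ ε : ℝ} (hε : 0 < ε) {Φ' : A → ℝ → X} (hΦ' : IsFenceOn F' Γ' τ₀ ε Φ' univ) :
    ∃ δ > (0 : ℝ), δ ≤ ε ∧ IsFenceOn F (hf.pushGerm ∘ Γ') τ₀ δ (fun a τ ↦ f (Φ' a τ)) univ := by
  classical
  choose W hW hWS δa hδa hδaε D hD using
    fun a : A ↦ hf.exists_localDatum_comp Γ' hε hΦ' isOpen_univ (mem_univ a)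
  -- a finite subcover by the interiors of the `W a`
  obtain ⟨T, hT⟩ := isCompact_univ.elim_finite_subcover (fun a ↦ interior (W a))
    (fun a ↦ isOpen_interior) fun a _ ↦ mem_iUnion.2 ⟨a, mem_interior_iff_mem_nhds.2 (hW a)⟩
  rcases T.eq_empty_or_nonempty with hTe | hTn
  · -- empty parameter space
    have hA : ∀ a : A, False := fun a ↦ by simpa [hTe] using hT (mem_univ a)
    exact ⟨ε, hε, le_rfl, ⟨fun p _ ↦ (hA p.1).elim, fun a _ ↦ (hA a).elim, fun a _ ↦ (hA a).elim⟩⟩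
  -- a common level radius
  set δ : ℝ := T.inf' hTn δa with hδdef
  have hδ : 0 < δ := (Finset.lt_inf'_iff hTn).2 fun a _ ↦ hδa a
  have hδle : ∀ a ∈ T, δ ≤ δa a := fun a ha ↦ Finset.inf'_le δa ha
  obtain ⟨a₁, ha₁⟩ := hTn
  have hδε : δ ≤ ε := (hδle a₁ ha₁).trans (hδaε a₁)
  refine ⟨δ, hδ, hδε, ⟨?_, fun a _ ↦ ?_, fun a _ ↦ ?_⟩⟩
  · -- continuity
    have hI : Ioo (τ₀ - δ) (τ₀ + δ) ⊆ Ioo (τ₀ - ε) (τ₀ + ε) := Ioo_subset_Ioo (by linarith) (by linarith)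
    exact hf.continuous.comp_continuousOn (hΦ'.cont.mono (prod_mono Subset.rfl hI))
  · -- base points
    show f (Φ' a τ₀) = f (ofLeafSpace (Γ' a).pt)
    rw [hΦ'.base a (mem_univ a)]
  · -- local levelling in the datum of a member of the subcover
    obtain ⟨i, hi, hai⟩ := mem_iUnion₂.1 (hT (mem_univ a))
    refine ⟨W i, mem_interior_iff_mem_nhds.1 hai, (D i).restrict inter_subset_left (hδle i hi),
      fun a' ha' τ hτ ↦ ?_⟩
    have hτ' : τ ∈ Ioo (τ₀ - δa i) (τ₀ + δa i) :=
      Ioo_subset_Ioo (by linarith [hδle i hi]) (by linarith [hδle i hi]) hτ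
    exact hD i a' ha'.1 τ hτ'

end IsFoliatedMap

/-! ## Reparametrising fences; changing the family of germs on the base set -/

namespace IsFenceOn

variable {G : A → F.GermSpace} {τ₀ ε : ℝ} {Φ : A → ℝ → M} {S : Set A}

/-- **Pulling a fence back along a continuous map of parameter spaces**: if `Φ` is a fence for
`G` over the whole of `A`, then `a ↦ Φ (π a)` is a fence for `G ∘ π` over the whole of `A₂`,
for any continuous `π : A₂ → A` (same local data at `π a`). [folklore] -/
theorem comp_right [TopologicalSpace A] {A₂ : Type*} [TopologicalSpace A₂] (h : IsFenceOn F G τ₀ ε Φ univ)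
    {π : A₂ → A} (hπ : Continuous π) : IsFenceOn F (G ∘ π) τ₀ ε (fun a ↦ Φ (π a)) univ := by
  refine ⟨?_, fun a _ ↦ h.base (π a) (mem_univ _), fun a _ ↦ ?_⟩
  · have hc : ContinuousOn (uncurry Φ ∘ Prod.map π id) (univ ×ˢ Ioo (τ₀ - ε) (τ₀ + ε)) :=
      h.cont.comp (hπ.prodMap continuous_id).continuousOn fun p hp ↦ ⟨mem_univ _, hp.2⟩
    exact hc
  · obtain ⟨U, hU, D, hD⟩ := h.local_level (π a) (mem_univ _)
    refine ⟨π ⁻¹' U, hπ.continuousAt.preimage_mem_nhds hU,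
      ⟨D.box, D.box_mem, D.φ, D.ψ, fun a' ha' ↦ D.germ_eq (π a') ⟨ha'.1, mem_univ _⟩,
        fun a' ha' ↦ D.pt_mem (π a') ⟨ha'.1, mem_univ _⟩, D.φ_ψ, D.ψ_φ, D.ψ_cont, D.ψ_inj⟩,
      fun a' ha' τ hτ ↦ hD (π a') ⟨ha'.1, mem_univ _⟩ τ hτ⟩

/-- **A fence for `G` over `S` is a fence for any family of germs equal to `G` on `S`.**
[folklore] -/
theorem congr_germ [TopologicalSpace A] {G' : A → F.GermSpace} (h : IsFenceOn F G τ₀ ε Φ S)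
    (hG : ∀ a ∈ S, G' a = G a) : IsFenceOn F G' τ₀ ε Φ S := by
  refine ⟨h.cont, fun a ha ↦ ?_, fun a ha ↦ ?_⟩
  · rw [hG a ha]
    exact h.base a ha
  · obtain ⟨U, hU, D, hD⟩ := h.local_level a ha
    refine ⟨U, hU, ⟨D.box, D.box_mem, D.φ, D.ψ, fun a' ha' ↦ ?_, fun a' ha' ↦ ?_, D.φ_ψ, D.ψ_φ,
      D.ψ_cont, D.ψ_inj⟩, hD⟩
    · rw [hG a' ha'.2]
      exact D.germ_eq a' ha'
    · rw [hG a' ha'.2]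
      exact D.pt_mem a' ha'

end IsFenceOn

/-! ## Continuous families of germs over preconnected sets -/

/-- **A continuous family of germs over a preconnected set lying over one point is constant**
(the fibres of the germ covering are discrete). [folklore] -/
theorem apply_eq_of_proj_eq_const [TopologicalSpace A] [Nonempty B] [LocallyConnectedSpace B]
    (G : C(A, F.GermSpace)) {E : Set A} (hE : IsPreconnected E) {q : F.LeafSpace}
    (hq : ∀ a ∈ E, (G a).proj = q) {a a' : A} (ha : a ∈ E) (ha' : a' ∈ E) : G a = G a' := by
  haveI := isPreconnected_iff_preconnectedSpace.1 hE
  exact (F.isCoveringMap_proj).const_of_comp (g := G ∘ (Subtype.val : E → A))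
    (G.continuous.comp continuous_subtype_val)
    (fun x y ↦ by show (G x).proj = (G y).proj; rw [hq _ x.2, hq _ y.2]) ⟨a, ha⟩ ⟨a', ha'⟩

/-- **Two continuous families of germs over a preconnected set, lifting the same leaf map and
equal at one point of the set, are equal on the set** (uniqueness of lifts). [folklore] -/
theorem apply_eq_of_proj_eq [TopologicalSpace A] [Nonempty B] [LocallyConnectedSpace B]
    (G₁ G₂ : C(A, F.GermSpace)) {E : Set A} (hE : IsPreconnected E)
    (hproj : ∀ a ∈ E, (G₁ a).proj = (G₂ a).proj) {a₀ : A} (ha₀ : a₀ ∈ E) (h₀ : G₁ a₀ = G₂ a₀)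
    {a : A} (ha : a ∈ E) : G₁ a = G₂ a := by
  haveI := isPreconnected_iff_preconnectedSpace.1 hE
  have key := (F.isCoveringMap_proj).eq_of_comp_eq (g₁ := G₁ ∘ (Subtype.val : E → A))
    (g₂ := G₂ ∘ (Subtype.val : E → A)) (G₁.continuous.comp continuous_subtype_val)
    (G₂.continuous.comp continuous_subtype_val)
    (funext fun x ↦ by show (G₁ x).proj = (G₂ x).proj; exact hproj _ x.2) ⟨a₀, ha₀⟩ h₀
  exact congr_fun key ⟨a, ha⟩

/-! ## Loops in a plaque are null-homotopic in the leaf -/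

/-- **A leaf loop running in a single plaque is null-homotopic in the leaf topology**: the plaque
is the homeomorphic image of the leaf model `B`, a real normed space, under the plaque map;
pull the loop back to `B` and interpolate linearly to its base point. [folklore] -/
theorem homotopic_refl_of_forall_mem_plaque [NormedSpace ℝ B] {e : OpenPartialHomeomorph M (B × ℝ)}
    (he : e ∈ F.atlas) {t : ℝ} {q : F.LeafSpace} (δ : Path q q)
    (hδ : ∀ s, ofLeafSpace (δ s) ∈ plaque e t) : δ.Homotopic (Path.refl q) := by
  -- the `B`-coordinate of the loop
  set b : I → B := fun s ↦ (e (ofLeafSpace (δ s))).1 with hbdef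
  have hb : Continuous b :=
    continuous_fst.comp (e.continuousOn.comp_continuous (F.continuous_ofLeafSpace.comp δ.continuous)
      fun s ↦ (hδ s).1)
  have hbδ : ∀ s, F.leafPlaqueMap e t (b s) = δ s := fun s ↦
    congrArg toLeafSpace (plaqueMap_fst_eq (hδ s))
  have hb01 : b 1 = b 0 := by
    show (e (ofLeafSpace (δ 1))).1 = (e (ofLeafSpace (δ 0))).1
    rw [δ.source, δ.target]
  -- the straight-line homotopy in `B`, mapped by the plaque map
  set Hf : I × I → F.LeafSpace := fun p ↦
    F.leafPlaqueMap e t ((1 - (p.1 : ℝ)) • b p.2 + (p.1 : ℝ) • b 0) with hHf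
  have hHc : Continuous Hf := by
    refine (F.continuous_leafPlaqueMap he t).comp ?_
    have hs : Continuous fun p : I × I ↦ ((p.1 : I) : ℝ) := continuous_induced_dom.comp continuous_fst
    exact ((continuous_const.sub hs).smul (hb.comp continuous_snd)).add (hs.smul continuous_const)
  refine ⟨{ toFun := Hf
            continuous_toFun := hHc
            map_zero_left := fun s ↦ ?_
            map_one_left := fun s ↦ ?_
            prop' := fun r s hs ↦ ?_ }⟩
  · show F.leafPlaqueMap e t ((1 - (0 : ℝ)) • b s + (0 : ℝ) • b 0) = δ s
    rw [sub_zero, one_smul, zero_smul, add_zero, hbδ]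
  · show F.leafPlaqueMap e t ((1 - (1 : ℝ)) • b s + (1 : ℝ) • b 0) = q
    rw [sub_self, zero_smul, one_smul, zero_add, hbδ, δ.source]
  · show F.leafPlaqueMap e t ((1 - (r : ℝ)) • b s + (r : ℝ) • b 0) = δ s
    rcases hs with rfl | rfl
    · rw [← add_smul, sub_add_cancel, one_smul, hbδ]
    · rw [hb01, ← add_smul, sub_add_cancel, one_smul, ← hb01, hbδ]

end Foliation

end Literature.Topology.FourManifolds
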